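import Mathlib
import Literature.Analysis.Calculus.IicRpowTails

/-!
# Route PhotonSphereChannels — tail integrals of a polynomially small potential on `(−∞, −½]`

Item stmt-FinalStateConjecture-10048 (`FixedModeChannels`), far side of the mode `ℓ = 0` after the
reflection `x ↦ −x`. For a continuous `V ≥ 0` with `V(x) ≤ ε(−x)^{−5/2}` on `x ≤ −½`:
integrability of `V`, `(−½ − y)V`, `(−1 − y)V` on the corresponding half-lines with
`∫ (−½−y)V ≤ 4ε`, `∫ (−1−y)V ≤ 2ε`, `∫_{(−∞,x]} V ≤ (2/3)ε(−x)^{−3/2}`, and the source majorant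
`sup_{x ≤ −1−τ} V ≤ ε(1+τ)^{−5/2}` (`rpowTail_facts`, from
`Literature.Analysis.Calculus.integrableOn_Iic_of_rpow_bound`). Used by
`Theorems.nearChannel_zero_of_rpow_tail`.
-/

noncomputable section

namespace Summit.FinalStateConjecture.FinalStateConjecture.Theorems

open Literature.Analysis.Calculus MeasureTheory Real Set Filter Topology

/-- `(1/2)^(−1/2) ≤ 2`. -/
theorem half_rpow_neg_half_le_two : (1 / 2 : ℝ) ^ (-(1 / 2 : ℝ)) ≤ 2 := by
  have h : (1 / 2 : ℝ) ^ (-(1 / 2 : ℝ)) = Real.sqrt 2 := by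
    rw [Real.rpow_neg (by norm_num), ← Real.sqrt_eq_rpow, ← Real.sqrt_inv]
    norm_num
  rw [h, show (2 : ℝ) = Real.sqrt 4 by
    rw [show (4 : ℝ) = 2 ^ 2 by norm_num, Real.sqrt_sq (by norm_num)]]
  exact Real.sqrt_le_sqrt (by norm_num)

/-- `y ↦ C(−y)^p` is integrable on `(−∞, c]` for `c < 0`, `p < −1`. -/
theorem integrableOn_Iic_const_mul_neg_rpow (C : ℝ) {c p : ℝ} (hc : c < 0) (hp : p < -1) :
    IntegrableOn (fun y : ℝ => C * (-y) ^ p) (Iic c) := by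
  have hc' : 0 < -c := by linarith
  have hgI : IntegrableOn (fun x : ℝ => C * x ^ p) (Ioi (-c)) :=
    (integrableOn_Ioi_rpow_of_lt hp hc').const_mul C
  have hgI' : IntegrableOn (fun x : ℝ => C * x ^ p) (Ici (-c)) :=
    (integrableOn_Ici_iff_integrableOn_Ioi enorm_ne_top).2 hgI
  rw [integrableOn_Iic_iff_comp_neg]
  simpa only [neg_neg] using hgI'

variable {V : ℝ → ℝ}

/-- **Tail integrals of a polynomially small potential.** See the module docstring. -/
theorem rpowTail_facts (hVc : Continuous V) (hV0 : ∀ x, 0 ≤ V x) {ε : ℝ} (hε : 0 < ε)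
    (hVε : ∀ x : ℝ, x ≤ -(1 / 2) → V x ≤ ε * (-x) ^ (-(5 : ℝ) / 2)) :
    IntegrableOn V (Iic (-(1 / 2))) ∧
    IntegrableOn (fun y => (-(1 / 2) - y) * V y) (Iic (-(1 / 2))) ∧
    (∫ y in Iic (-(1 / 2)), (-(1 / 2) - y) * V y) ≤ 4 * ε ∧
    IntegrableOn (fun y => (-1 - y) * V y) (Iic (-1)) ∧
    (∫ y in Iic (-1), (-1 - y) * V y) ≤ 2 * ε ∧
    (∀ x : ℝ, x ≤ -(1 / 2) → (∫ y in Iic x, V y) ≤ 2 / 3 * ε * (-x) ^ (-(3 : ℝ) / 2)) ∧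
    (∀ τ : ℝ, 0 ≤ τ → ∀ x : ℝ, x ≤ -1 - τ → V x ≤ ε * (1 + τ) ^ (-(5 : ℝ) / 2)) := by
  set a : ℝ := -1 with ha
  set A : ℝ := -(1 / 2) with hA
  have haA : a < A := by norm_num [ha, hA]
  have hrp : ∀ y : ℝ, y ≤ A → (-y) * (-y) ^ (-(5 : ℝ) / 2) = (-y) ^ (-(3 : ℝ) / 2) := by
    intro y hy
    have hy0 : 0 < -y := by simp only [hA] at hy; linarith
    rw [← Real.rpow_one_add' hy0.le (by norm_num)]
    norm_num
  have hbV : ∀ y, y ≤ A → |V y| ≤ ε * (-y) ^ (-(5 : ℝ) / 2) := fun y hy => by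
    rw [abs_of_nonneg (hV0 y)]; exact hVε y hy
  have hbWA : ∀ y, y ≤ A → |(A - y) * V y| ≤ ε * (-y) ^ (-(3 : ℝ) / 2) := by
    intro y hy
    have hy0 : 0 < -y := by simp only [hA] at hy; linarith
    rw [abs_mul, abs_of_nonneg (by linarith : 0 ≤ A - y), abs_of_nonneg (hV0 y), ← hrp y hy]
    have h1 : A - y ≤ -y := by simp only [hA]; linarith
    calc (A - y) * V y ≤ (-y) * (ε * (-y) ^ (-(5 : ℝ) / 2)) :=
          mul_le_mul h1 (hVε y hy) (hV0 y) hy0.le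
      _ = ε * ((-y) * (-y) ^ (-(5 : ℝ) / 2)) := by ring
  have hbWa : ∀ y, y ≤ a → |(a - y) * V y| ≤ ε * (-y) ^ (-(3 : ℝ) / 2) := by
    intro y hy
    have hyA : y ≤ A := hy.trans haA.le
    have hy0 : 0 < -y := by simp only [ha] at hy; linarith
    rw [abs_mul, abs_of_nonneg (by linarith : 0 ≤ a - y), abs_of_nonneg (hV0 y), ← hrp y hyA]
    have h1 : a - y ≤ -y := by simp only [ha]; linarith
    calc (a - y) * V y ≤ (-y) * (ε * (-y) ^ (-(5 : ℝ) / 2)) :=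
          mul_le_mul h1 (hVε y hyA) (hV0 y) hy0.le
      _ = ε * ((-y) * (-y) ^ (-(5 : ℝ) / 2)) := by ring
  obtain ⟨hViA, -⟩ := integrableOn_Iic_of_rpow_bound hVc (by norm_num : A < 0)
    (by norm_num : (-(5 : ℝ) / 2) < -1) hbV
  obtain ⟨hWiA, hIWA⟩ := integrableOn_Iic_of_rpow_bound ((continuous_const.sub continuous_id).mul hVc)
    (by norm_num : A < 0) (by norm_num : (-(3 : ℝ) / 2) < -1) hbWA
  obtain ⟨hWia, hIWa⟩ := integrableOn_Iic_of_rpow_bound ((continuous_const.sub continuous_id).mul hVc)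
    (by norm_num : a < 0) (by norm_num : (-(3 : ℝ) / 2) < -1) hbWa
  have hIV : ∀ x, x ≤ A → (∫ y in Iic x, V y) ≤ 2 / 3 * ε * (-x) ^ (-(3 : ℝ) / 2) := by
    intro x hx
    have hx0 : x < 0 := by simp only [hA] at hx; linarith
    obtain ⟨-, h⟩ := integrableOn_Iic_of_rpow_bound hVc hx0 (by norm_num : (-(5 : ℝ) / 2) < -1)
      (fun y hy => hbV y (hy.trans hx))
    have habs : (∫ y in Iic x, V y) = ∫ y in Iic x, |V y| :=
      setIntegral_congr_fun measurableSet_Iic fun y _ => (abs_of_nonneg (hV0 y)).symm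
    rw [habs]
    refine h.trans (le_of_eq ?_)
    rw [show (-(5 : ℝ) / 2 + 1) = -(3 : ℝ) / 2 by norm_num, show (-(-(5 : ℝ) / 2) - 1) = 3 / 2 by norm_num]
    ring
  have hnnW : ∀ c : ℝ, ∀ y ∈ Iic c, 0 ≤ (c - y) * V y := fun c y hy =>
    mul_nonneg (sub_nonneg.2 hy) (hV0 y)
  have hQ : (∫ y in Iic A, (A - y) * V y) ≤ 4 * ε := by
    have habs : (∫ y in Iic A, (A - y) * V y) = ∫ y in Iic A, |(A - y) * V y| :=
      setIntegral_congr_fun measurableSet_Iic fun y hy => (abs_of_nonneg (hnnW A y hy)).symm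
    rw [habs]
    refine hIWA.trans ?_
    have h1 : (-A) ^ (-(3 : ℝ) / 2 + 1) ≤ 2 := by
      simp only [hA, neg_neg]
      rw [show (-(3 : ℝ) / 2 + 1) = -(1 / 2) by norm_num]
      exact half_rpow_neg_half_le_two
    rw [show (-(-(3 : ℝ) / 2) - 1) = 1 / 2 by norm_num]
    have := mul_le_mul_of_nonneg_left h1 hε.le
    rw [mul_div_assoc] at *
    linarith
  have hCV : (∫ y in Iic a, (a - y) * V y) ≤ 2 * ε := by
    have habs : (∫ y in Iic a, (a - y) * V y) = ∫ y in Iic a, |(a - y) * V y| :=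
      setIntegral_congr_fun measurableSet_Iic fun y hy => (abs_of_nonneg (hnnW a y hy)).symm
    rw [habs]
    have e1 : ε * (-a) ^ (-(3 : ℝ) / 2 + 1) / (-(-(3 : ℝ) / 2) - 1) = 2 * ε := by
      rw [show -a = (1 : ℝ) by norm_num [ha], Real.one_rpow]; ring
    exact hIWa.trans (le_of_eq e1)
  -- the source majorant
  have hVτ : ∀ τ : ℝ, 0 ≤ τ → ∀ x, x ≤ a - τ → V x ≤ ε * (1 + τ) ^ (-(5 : ℝ) / 2) := by
    intro τ hτ x hx
    have hxA : x ≤ A := by simp only [ha] at hx; simp only [hA]; linarith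
    have h1 : 1 + τ ≤ -x := by simp only [ha] at hx; linarith
    have hτ1 : 0 < 1 + τ := by linarith
    refine (hVε x hxA).trans (mul_le_mul_of_nonneg_left ?_ hε.le)
    exact Real.rpow_le_rpow_of_nonpos hτ1 h1 (by norm_num)
  exact ⟨hViA, hWiA, hQ, hWia, hCV, hIV, hVτ⟩

end Summit.FinalStateConjecture.FinalStateConjecture.Theorems
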